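import Summits.QuantumAdvantage.QuantumAdvantage.Theorems.CharDialJLinCore
import Summits.QuantumAdvantage.QuantumAdvantage.Theorems.CharDialJLinDegree
import Summits.QuantumAdvantage.AdviceFreeQNC0.WalkHardFShotsSqrt
import Summits.QuantumAdvantage.AdviceFreeQNC0.WalkHardFFewReaders
import Summits.QuantumAdvantage.QuantumAdvantage.Theses.OddPrimeWalk
import HarnessLib

/-!
# Cell qa-qnc0 / decomp-qadv (odd primes): CharDial's item 32604 carved down to the VPE core BY NAME (R6 + R8 + the peeling law)

TREE-READY PART 6 of the node `HOME/decomp-qadv-lens-6/g9/PeelDial.lean` (decomp-qadv-lens-6 g9, rev 3, §16), ZERO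
`def … : Prop` (every hardness class is spelled out in the statements; `JLinData.shots` is an `ℕ`-valued definition).

Part 5 (`CharDialJLinCore`) proved `pres_iff_core`: item 32604 of route CharDial AT `p` (hardness of α's u-walk game against
junta(`≤ log₂ n`) ⊕ one-`𝔽_p`-form cuts) ⟺ hardness on `L`-CORES.  The lineage's two proved ceilings that are HYPOTHESIS
CLASSES on arbitrary polylog-degree strategies — R6 `walkHardFShotsSqrt` (item 23022 `ShotsSqrtOdd`) and R8
`walkHardFFewReaders` (item 23108 `FewReadersOdd`) — apply inside cores, because junta ⊕ form cuts have `𝔽_p`-degree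
`≤ log₂ n + p − 1 ≤ (log₂ n)²` (`hasDegF_jlin`, `Theorems/CharDialJLinDegree.lean`).  Hence, BY NAME:

* **`core_iff_vpe`** (`p ≥ 5`): core hardness ⟺ hardness on cores that are moreover `√n`-DENSE in shots
  (`¬ shots²·(log₂ n)⁷ ≤ n`) and have EVERY adjacent bit pair FAR-READ by more than `(log₂ n)²` cuts — literally the
  hypothesis class of OddPrimeWalk's research crux `ManyReadersSqrtOdd` (23109) at `C = 2`, intersected with `L`-cores and
  junta ⊕ one-form presentations (the VPE core);
* **`pres_iff_vpe`**, **`charDial_walkHardFJLinOdd_iff_vpe`**: item 32604 ⟺ VPE-core hardness at every `p ≥ 5`;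
* **`vpe_of_manyReaders`**: 23109 ⟹ VPE-core hardness (⟹ 32604 by `charDial_walkHardFJLinOdd_of_vpe`, one line, left to the node file);
* `charDial_closes_of_vpe`: CharDial's leaf from 32603, VPE-core hardness, 32599, 32600.

WHAT THIS IS NOT: VPE-core hardness is OPEN (it is where every proved ceiling of the lineage bites); nothing here touches
`DegLiftOdd` / `FrobLiftOdd`; separation is not moved.
-/

noncomputable section

namespace Summit.QuantumAdvantage.AdviceFreeQNC0.JLinPeel

open Finset Summit.QuantumAdvantage.AdviceFreeQNC0 JLinData

variable {p : ℕ} [Fact p.Prime] {n : ℕ}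

/-- The maximal number of fired cuts over all inputs. -/
def JLinData.shots (D : JLinData p n) : ℕ :=
  univ.sup fun u : Fin n → Bool => (univ.filter fun g : Fin (n + 1) => D.strat g u = true).card

omit [Fact p.Prime] in
/-- CharDial sub-characteristic helper `JLinData.shots_le` (lens-6 g8 LAND package; see the module docstring). -/
theorem JLinData.shots_le (D : JLinData p n) (u : Fin n → Bool) :
    (univ.filter fun g : Fin (n + 1) => D.strat g u = true).card ≤ D.shots :=
  Finset.le_sup (f := fun u : Fin n → Bool => (univ.filter fun g : Fin (n + 1) => D.strat g u = true).card) (mem_univ u)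

/-- Junta(`≤ log₂ n`) ⊕ form cuts have `𝔽_p`-degree `≤ (log₂ n)²` once `n ≥ 2^p` (`hasDegF_jlin`). -/
theorem JLinData.strat_hasDegF (D : JLinData p n) (hJ : ∀ g, (D.J g).card ≤ Nat.log 2 n) (hn : 2 ^ p ≤ n)
    (g : Fin (n + 1)) : HasDegF p (D.strat g) ((Nat.log 2 n) ^ 2) := by
  have hp2 : 2 ≤ p := (Fact.out : p.Prime).two_le
  have hlog : p ≤ Nat.log 2 n := Nat.le_log_of_pow_le (by norm_num) hn
  have hdeg := hasDegF_jlin (D.J g) (D.a g) (D.h g) (D.hJ g) (D.strat g) (fun u => rfl)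
  have hle : (D.J g).card + (p - 1) ≤ (Nat.log 2 n) ^ 2 := by
    have h1 : (D.J g).card + (p - 1) ≤ Nat.log 2 n + (Nat.log 2 n - 1) := by have := hJ g; omega
    have h2 : Nat.log 2 n + (Nat.log 2 n - 1) ≤ Nat.log 2 n * Nat.log 2 n := by
      have hL : 2 ≤ Nat.log 2 n := le_trans hp2 hlog
      calc Nat.log 2 n + (Nat.log 2 n - 1) ≤ 2 * Nat.log 2 n := by omega
        _ ≤ Nat.log 2 n * Nat.log 2 n := Nat.mul_le_mul_right _ hL
    rw [pow_two]; exact h1.trans h2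
  unfold HasDegF at hdeg ⊢
  exact Literature.Computability.MetaComplexity.Smolensky.lowDeg_mono hle hdeg

/-- **Carving by the proved ceilings** (`p ≥ 5`): VPE-core hardness implies core hardness — a core that is not `√n`-dense in
shots falls to R6 (`walkHardFShotsSqrt`, `B :=` its shot supremum), one with SOME adjacent pair read by few far cuts falls to R8
(`walkHardFFewReaders`); what is left is the VPE core. -/
theorem core_of_vpe (p : ℕ) [Fact p.Prime] (hp : 5 ≤ p)
    (hV : ∀ C' : ℕ, ∃ θ : ℝ, θ < 1 ∧ ∃ n₀ : ℕ, ∀ n ≥ n₀, ∀ (c : ℕ) (D : JLinData p n),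
      (∀ g, (D.J g).card ≤ Nat.log 2 n) → (∀ g, (D.suppForm g).Nonempty → D.priv g < C' * Nat.log 2 n) →
        ¬ (D.shots ^ 2 * (Nat.log 2 n) ^ 7 ≤ n) →
        (∀ w a : ℕ, ∀ S : Finset (Fin (n + 1)), w ≤ (Nat.log 2 n) ^ 2 → a + 2 ≤ n → S.card ≤ (Nat.log 2 n) ^ 2 →
          ∃ g : Fin (n + 1), g ∉ S ∧ (g.val + w < a ∨ a + 2 + w < g.val) ∧
            ∃ u v : Fin n → Bool, (∀ i : Fin n, i.val ≠ a → i.val ≠ a + 1 → u i = v i) ∧ D.strat g u ≠ D.strat g v) →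
        (winCount c D.strat : ℝ) ≤ θ * (2 : ℝ) ^ n) :
    ∀ C' : ℕ, ∃ θ : ℝ, θ < 1 ∧ ∃ n₀ : ℕ, ∀ n ≥ n₀, ∀ (c : ℕ) (D : JLinData p n),
      (∀ g, (D.J g).card ≤ Nat.log 2 n) → (∀ g, (D.suppForm g).Nonempty → D.priv g < C' * Nat.log 2 n) →
        (winCount c D.strat : ℝ) ≤ θ * (2 : ℝ) ^ n := by
  intro C'
  obtain ⟨θ₁, hθ₁, hS⟩ := walkHardFShotsSqrt p (by omega)
  obtain ⟨n₁, hn₁⟩ := hS 2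
  obtain ⟨θ₂, hθ₂, hF⟩ := walkHardFFewReaders p (by omega)
  obtain ⟨n₂, hn₂⟩ := hF 2
  obtain ⟨θ₃, hθ₃, n₃, hn₃⟩ := hV C'
  refine ⟨max θ₁ (max θ₂ θ₃), max_lt hθ₁ (max_lt hθ₂ hθ₃), max (max n₁ n₂) (max n₃ (2 ^ p)), fun n hn c D hJ hcore => ?_⟩
  have hn₁' : n₁ ≤ n := le_trans (le_max_left _ _) (le_trans (le_max_left _ _) hn)
  have hn₂' : n₂ ≤ n := le_trans (le_max_right _ _) (le_trans (le_max_left _ _) hn)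
  have hn₃' : n₃ ≤ n := le_trans (le_max_left _ _) (le_trans (le_max_right _ _) hn)
  have hnp : 2 ^ p ≤ n := le_trans (le_max_right _ _) (le_trans (le_max_right _ _) hn)
  have hdeg : ∀ g, HasDegF p (D.strat g) ((Nat.log 2 n) ^ 2) := fun g => D.strat_hasDegF hJ hnp g
  have h2n : (0 : ℝ) ≤ (2 : ℝ) ^ n := by positivity
  have hθmax₁ : θ₁ * (2 : ℝ) ^ n ≤ max θ₁ (max θ₂ θ₃) * (2 : ℝ) ^ n :=
    mul_le_mul_of_nonneg_right (le_max_left _ _) h2n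
  have hθmax₂ : θ₂ * (2 : ℝ) ^ n ≤ max θ₁ (max θ₂ θ₃) * (2 : ℝ) ^ n :=
    mul_le_mul_of_nonneg_right (le_trans (le_max_left _ _) (le_max_right _ _)) h2n
  have hθmax₃ : θ₃ * (2 : ℝ) ^ n ≤ max θ₁ (max θ₂ θ₃) * (2 : ℝ) ^ n :=
    mul_le_mul_of_nonneg_right (le_trans (le_max_right _ _) (le_max_right _ _)) h2n
  by_cases hdense : D.shots ^ 2 * (Nat.log 2 n) ^ 7 ≤ n
  · have h := hn₁ n hn₁' c D.shots D.strat hdeg (fun u => D.shots_le u) (by simpa using hdense)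
    exact le_trans (by exact_mod_cast h) hθmax₁
  · by_cases hfar : (∀ w a : ℕ, ∀ S : Finset (Fin (n + 1)), w ≤ (Nat.log 2 n) ^ 2 → a + 2 ≤ n → S.card ≤ (Nat.log 2 n) ^ 2 →
          ∃ g : Fin (n + 1), g ∉ S ∧ (g.val + w < a ∨ a + 2 + w < g.val) ∧
            ∃ u v : Fin n → Bool, (∀ i : Fin n, i.val ≠ a → i.val ≠ a + 1 → u i = v i) ∧ D.strat g u ≠ D.strat g v)
    · exact (hn₃ n hn₃' c D hJ hcore hdense hfar).trans hθmax₃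
    · push Not at hfar
      obtain ⟨w, a, S, hw, ha, hSc, hall⟩ := hfar
      have h := hn₂ n hn₂' c w a hw ha D.strat hdeg S hSc (fun g hg hgfar u v huv => hall g hg hgfar u v huv)
      exact le_trans (by exact_mod_cast h) hθmax₂

/-- The converse is trivial. -/
theorem vpe_of_core (p : ℕ) [Fact p.Prime]
    (hC : ∀ C' : ℕ, ∃ θ : ℝ, θ < 1 ∧ ∃ n₀ : ℕ, ∀ n ≥ n₀, ∀ (c : ℕ) (D : JLinData p n),
      (∀ g, (D.J g).card ≤ Nat.log 2 n) → (∀ g, (D.suppForm g).Nonempty → D.priv g < C' * Nat.log 2 n) →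
        (winCount c D.strat : ℝ) ≤ θ * (2 : ℝ) ^ n) :
    ∀ C' : ℕ, ∃ θ : ℝ, θ < 1 ∧ ∃ n₀ : ℕ, ∀ n ≥ n₀, ∀ (c : ℕ) (D : JLinData p n),
      (∀ g, (D.J g).card ≤ Nat.log 2 n) → (∀ g, (D.suppForm g).Nonempty → D.priv g < C' * Nat.log 2 n) →
        ¬ (D.shots ^ 2 * (Nat.log 2 n) ^ 7 ≤ n) →
        (∀ w a : ℕ, ∀ S : Finset (Fin (n + 1)), w ≤ (Nat.log 2 n) ^ 2 → a + 2 ≤ n → S.card ≤ (Nat.log 2 n) ^ 2 →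
          ∃ g : Fin (n + 1), g ∉ S ∧ (g.val + w < a ∨ a + 2 + w < g.val) ∧
            ∃ u v : Fin n → Bool, (∀ i : Fin n, i.val ≠ a → i.val ≠ a + 1 → u i = v i) ∧ D.strat g u ≠ D.strat g v) →
        (winCount c D.strat : ℝ) ≤ θ * (2 : ℝ) ^ n := fun C' => by
  obtain ⟨θ, hθ, n₀, hn₀⟩ := hC C'
  exact ⟨θ, hθ, n₀, fun n hn c D hJ hcore _ _ => hn₀ n hn c D hJ hcore⟩

/-- **Core hardness ⟺ VPE-core hardness** (`p ≥ 5`). -/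
theorem core_iff_vpe (p : ℕ) [Fact p.Prime] (hp : 5 ≤ p) :
    (∀ C' : ℕ, ∃ θ : ℝ, θ < 1 ∧ ∃ n₀ : ℕ, ∀ n ≥ n₀, ∀ (c : ℕ) (D : JLinData p n),
      (∀ g, (D.J g).card ≤ Nat.log 2 n) → (∀ g, (D.suppForm g).Nonempty → D.priv g < C' * Nat.log 2 n) →
        (winCount c D.strat : ℝ) ≤ θ * (2 : ℝ) ^ n) ↔
    (∀ C' : ℕ, ∃ θ : ℝ, θ < 1 ∧ ∃ n₀ : ℕ, ∀ n ≥ n₀, ∀ (c : ℕ) (D : JLinData p n),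
      (∀ g, (D.J g).card ≤ Nat.log 2 n) → (∀ g, (D.suppForm g).Nonempty → D.priv g < C' * Nat.log 2 n) →
        ¬ (D.shots ^ 2 * (Nat.log 2 n) ^ 7 ≤ n) →
        (∀ w a : ℕ, ∀ S : Finset (Fin (n + 1)), w ≤ (Nat.log 2 n) ^ 2 → a + 2 ≤ n → S.card ≤ (Nat.log 2 n) ^ 2 →
          ∃ g : Fin (n + 1), g ∉ S ∧ (g.val + w < a ∨ a + 2 + w < g.val) ∧
            ∃ u v : Fin n → Bool, (∀ i : Fin n, i.val ≠ a → i.val ≠ a + 1 → u i = v i) ∧ D.strat g u ≠ D.strat g v) →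
        (winCount c D.strat : ℝ) ≤ θ * (2 : ℝ) ^ n) :=
  ⟨vpe_of_core p, core_of_vpe p hp⟩

/-- **Item 32604 at `p` ⟺ VPE-core hardness** (`p ≥ 5`; part 5's `pres_iff_core` + `core_iff_vpe`). -/
theorem pres_iff_vpe (p : ℕ) [Fact p.Prime] (hp : 5 ≤ p) :
    (∃ θ : ℝ, θ < 1 ∧ ∃ n₀ : ℕ, ∀ n ≥ n₀, ∀ c : ℕ, ∀ y : Fin (n + 1) → (Fin n → Bool) → Bool,
      (∀ g, ∃ J : Finset (Fin n), J.card ≤ Nat.log 2 n ∧ ∃ a : Fin n → ZMod p, ∃ h : (Fin n → Bool) → ZMod p → Bool,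
          (∀ u v : Fin n → Bool, (∀ i ∈ J, u i = v i) → ∀ s, h u s = h v s) ∧
            ∀ u, y g u = h u (∑ i, if u i then a i else 0)) →
        ((Finset.univ.filter fun u : Fin n → Bool => ringWinU c y u = true).card : ℝ) ≤ θ * (2 : ℝ) ^ n) ↔
    (∀ C' : ℕ, ∃ θ : ℝ, θ < 1 ∧ ∃ n₀ : ℕ, ∀ n ≥ n₀, ∀ (c : ℕ) (D : JLinData p n),
      (∀ g, (D.J g).card ≤ Nat.log 2 n) → (∀ g, (D.suppForm g).Nonempty → D.priv g < C' * Nat.log 2 n) →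
        ¬ (D.shots ^ 2 * (Nat.log 2 n) ^ 7 ≤ n) →
        (∀ w a : ℕ, ∀ S : Finset (Fin (n + 1)), w ≤ (Nat.log 2 n) ^ 2 → a + 2 ≤ n → S.card ≤ (Nat.log 2 n) ^ 2 →
          ∃ g : Fin (n + 1), g ∉ S ∧ (g.val + w < a ∨ a + 2 + w < g.val) ∧
            ∃ u v : Fin n → Bool, (∀ i : Fin n, i.val ≠ a → i.val ≠ a + 1 → u i = v i) ∧ D.strat g u ≠ D.strat g v) →
        (winCount c D.strat : ℝ) ≤ θ * (2 : ℝ) ^ n) :=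
  (pres_iff_core p (by omega)).trans (core_iff_vpe p hp)

/-- **CharDial item 32604 ⟺ VPE-core hardness at every prime `p ≥ 5`.** -/
theorem charDial_walkHardFJLinOdd_iff_vpe :
    Summit.QuantumAdvantage.QuantumAdvantage.Theses.CharDial.WalkHardFJLinOdd ↔ ∀ (p : ℕ) [Fact p.Prime], 5 ≤ p →
      ∀ C' : ℕ, ∃ θ : ℝ, θ < 1 ∧ ∃ n₀ : ℕ, ∀ n ≥ n₀, ∀ (c : ℕ) (D : JLinData p n),
      (∀ g, (D.J g).card ≤ Nat.log 2 n) → (∀ g, (D.suppForm g).Nonempty → D.priv g < C' * Nat.log 2 n) →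
        ¬ (D.shots ^ 2 * (Nat.log 2 n) ^ 7 ≤ n) →
        (∀ w a : ℕ, ∀ S : Finset (Fin (n + 1)), w ≤ (Nat.log 2 n) ^ 2 → a + 2 ≤ n → S.card ≤ (Nat.log 2 n) ^ 2 →
          ∃ g : Fin (n + 1), g ∉ S ∧ (g.val + w < a ∨ a + 2 + w < g.val) ∧
            ∃ u v : Fin n → Bool, (∀ i : Fin n, i.val ≠ a → i.val ≠ a + 1 → u i = v i) ∧ D.strat g u ≠ D.strat g v) →
        (winCount c D.strat : ℝ) ≤ θ * (2 : ℝ) ^ n :=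
  ⟨fun h p _ hp => (pres_iff_vpe p hp).1 (h p hp), fun hV p _ hp => (pres_iff_vpe p hp).2 (hV p hp)⟩

/-- **CharDial item 32604 ⟸ VPE-core hardness** (the `→` half, in `closes` shape). -/
theorem charDial_walkHardFJLinOdd_of_vpe
    (hV : ∀ (p : ℕ) [Fact p.Prime], 5 ≤ p →
      ∀ C' : ℕ, ∃ θ : ℝ, θ < 1 ∧ ∃ n₀ : ℕ, ∀ n ≥ n₀, ∀ (c : ℕ) (D : JLinData p n),
      (∀ g, (D.J g).card ≤ Nat.log 2 n) → (∀ g, (D.suppForm g).Nonempty → D.priv g < C' * Nat.log 2 n) →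
        ¬ (D.shots ^ 2 * (Nat.log 2 n) ^ 7 ≤ n) →
        (∀ w a : ℕ, ∀ S : Finset (Fin (n + 1)), w ≤ (Nat.log 2 n) ^ 2 → a + 2 ≤ n → S.card ≤ (Nat.log 2 n) ^ 2 →
          ∃ g : Fin (n + 1), g ∉ S ∧ (g.val + w < a ∨ a + 2 + w < g.val) ∧
            ∃ u v : Fin n → Bool, (∀ i : Fin n, i.val ≠ a → i.val ≠ a + 1 → u i = v i) ∧ D.strat g u ≠ D.strat g v) →
        (winCount c D.strat : ℝ) ≤ θ * (2 : ℝ) ^ n) :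
    Summit.QuantumAdvantage.QuantumAdvantage.Theses.CharDial.WalkHardFJLinOdd :=
  charDial_walkHardFJLinOdd_iff_vpe.2 hV

/-- **OddPrimeWalk's research crux 23109 `ManyReadersSqrtOdd` ⟹ VPE-core hardness** (at `C = 2`). -/
theorem vpe_of_manyReaders (hM : Summit.QuantumAdvantage.QuantumAdvantage.Theses.OddPrimeWalk.ManyReadersSqrtOdd) (p : ℕ) [Fact p.Prime] (hp : 5 ≤ p) :
    ∀ C' : ℕ, ∃ θ : ℝ, θ < 1 ∧ ∃ n₀ : ℕ, ∀ n ≥ n₀, ∀ (c : ℕ) (D : JLinData p n),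
      (∀ g, (D.J g).card ≤ Nat.log 2 n) → (∀ g, (D.suppForm g).Nonempty → D.priv g < C' * Nat.log 2 n) →
        ¬ (D.shots ^ 2 * (Nat.log 2 n) ^ 7 ≤ n) →
        (∀ w a : ℕ, ∀ S : Finset (Fin (n + 1)), w ≤ (Nat.log 2 n) ^ 2 → a + 2 ≤ n → S.card ≤ (Nat.log 2 n) ^ 2 →
          ∃ g : Fin (n + 1), g ∉ S ∧ (g.val + w < a ∨ a + 2 + w < g.val) ∧
            ∃ u v : Fin n → Bool, (∀ i : Fin n, i.val ≠ a → i.val ≠ a + 1 → u i = v i) ∧ D.strat g u ≠ D.strat g v) →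
        (winCount c D.strat : ℝ) ≤ θ * (2 : ℝ) ^ n := by
  intro C'
  obtain ⟨θ, hθ, hC⟩ := hM p hp
  obtain ⟨n₀, hn₀⟩ := hC 2
  refine ⟨θ, hθ, max n₀ (2 ^ p), fun n hn c D hJ _ hdense hfar => ?_⟩
  have hnp : 2 ^ p ≤ n := le_trans (le_max_right _ _) hn
  have hdeg : ∀ g, HasDegF p (D.strat g) ((Nat.log 2 n) ^ 2) := fun g => D.strat_hasDegF hJ hnp g
  have h := hn₀ n (le_trans (le_max_left _ _) hn) c D.strat hdeg (by simpa [JLinData.shots] using hdense)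
    (fun w a S hw ha hS => hfar w a S hw ha hS)
  exact_mod_cast h

-- NOTE (landing hygiene): the one-line corollary `ManyReadersSqrtOdd → CharDial.WalkHardFJLinOdd`
-- (`charDial_walkHardFJLinOdd_of_vpe (fun p _ hp => vpe_of_manyReaders hM p hp)`) is deliberately NOT declared here: its
-- hypothesis is a registered item (23109), so the audit would class it `proof-of-item` (a CONDITIONAL close of 32604); the
-- node file `PeelDial.lean` carries it as `closes32604_of_manyReaders`.

/-- **CharDial's leaf from `FrobStructureLaw` (32603), VPE-core hardness, `FrobLiftOdd` (32599), `DegLiftOdd` (32600).** -/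
theorem charDial_closes_of_vpe (hL : Summit.QuantumAdvantage.QuantumAdvantage.Theses.CharDial.FrobStructureLaw)
    (hV : ∀ (p : ℕ) [Fact p.Prime], 5 ≤ p →
      ∀ C' : ℕ, ∃ θ : ℝ, θ < 1 ∧ ∃ n₀ : ℕ, ∀ n ≥ n₀, ∀ (c : ℕ) (D : JLinData p n),
      (∀ g, (D.J g).card ≤ Nat.log 2 n) → (∀ g, (D.suppForm g).Nonempty → D.priv g < C' * Nat.log 2 n) →
        ¬ (D.shots ^ 2 * (Nat.log 2 n) ^ 7 ≤ n) →
        (∀ w a : ℕ, ∀ S : Finset (Fin (n + 1)), w ≤ (Nat.log 2 n) ^ 2 → a + 2 ≤ n → S.card ≤ (Nat.log 2 n) ^ 2 →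
          ∃ g : Fin (n + 1), g ∉ S ∧ (g.val + w < a ∨ a + 2 + w < g.val) ∧
            ∃ u v : Fin n → Bool, (∀ i : Fin n, i.val ≠ a → i.val ≠ a + 1 → u i = v i) ∧ D.strat g u ≠ D.strat g v) →
        (winCount c D.strat : ℝ) ≤ θ * (2 : ℝ) ^ n)
    (hLift : Summit.QuantumAdvantage.QuantumAdvantage.Theses.CharDial.FrobLiftOdd) (hD : Summit.QuantumAdvantage.QuantumAdvantage.Theses.CharDial.DegLiftOdd) :
    Summit.QuantumAdvantage.AdviceFreeQNC0.AdviceFreeQNC0Odd :=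
  charDial_closes_of_core hL (fun p _ hp => core_of_vpe p hp (hV p hp)) hLift hD

end Summit.QuantumAdvantage.AdviceFreeQNC0.JLinPeel

end
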